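import Summits.RiemannHypothesis.RiemannHypothesis.Theorems.ScrewLemmaKProfileBernoulliParseval
import Summits.RiemannHypothesis.RiemannHypothesis.Theorems.ScrewLemmaKCoprofileDensityApprox
import Summits.RiemannHypothesis.RiemannHypothesis.Theorems.ScrewLemmaKCoprofileDensityLimit
import HarnessLib

/-!
# K1 `CoprofileIsometry` for `C¹` data by density (route ScrewLemmaKCoprofile; stmt-RiemannHypothesis-21612)

`profile_isometry`: for every `g ∈ C¹[0,1]` with `g(1) = 0`, `∫₀¹ g = 0` and `(h − h₀)²/y² ∈ L¹(0,1)`,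

  `∫₀¹ (h − h₀)² y⁻² dy + h₀² = (4π²)⁻¹ ∫₀¹ Φ_g²`,   `Φ_g(t) = Σ_{n ≤ 1/t} g′(nt)/n`.

Proof (desk brief rh-idea-5 SKETCH-21612-K1.md §2, "density lemma"): take the `C²` approximants `p_k` of
`ScrewLemmaKCoprofileDensityApprox.exists_smooth_approx` (`p_k(1) = 0`, `∫p_k = 0`, `sup|p_k′ − g′| ≤ 1/(k+1)`);
the `C²` isometry (`ProfileBernoulli.coprofileIsometry_C2`) applied to `p_k − p_m` and the co-profile bound give
`∫₀¹ (ψ_k − ψ_m)² y⁻² ≤ (4π²)⁻¹·50(δ_k + δ_m)²`; the truncation lemma (`setIntegral_sq_div_le_of_approx`, using the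
item's integrability proviso for `ψ_g`) turns this into `∫₀¹ (ψ_k − ψ_g)² y⁻² → 0`; Cauchy–Schwarz continuity gives
`∫ψ_k²/y² → ∫ψ_g²/y²`, `∫Φ_k² → ∫Φ_g²`, and `h₀(p_k) → h₀(g)`; the identity passes to the limit.  The
`u^{-1/2}`-moment of admissibility is not used.  The route-decl closer is in `ScrewLemmaKCoprofileCoprofileIsometry`.

RH-free real analysis; RH is NOT proved by this file or this route, and nothing here bears on the truth of RH.
-/

noncomputable section

set_option linter.dupNamespace false

namespace Summit.RiemannHypothesis.RiemannHypothesis.Theorems.ScrewLemmaKCoprofile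

open MeasureTheory Set Filter Topology
open Summit.RiemannHypothesis.RiemannHypothesis.Theorems.IntegerScrew
open scoped BigOperators

/-! ## measurability and integrability of the profile deviation `ψ = h − h₀` on `(0,1)` -/

/-- `ψ_f` is a.e.-strongly measurable on `(0,1)` (it agrees there with the parametric integral `psiInt f`).
[folklore] -/
theorem aestronglyMeasurable_profile_sub_plateau {f : ℝ → ℝ} (hC : ContDiffOn ℝ 1 f (Icc 0 1))
    (h1 : f 1 = 0) (hI : ∫ u in (0:ℝ)..1, f u = 0) :
    AEStronglyMeasurable (fun y => latticeProfile f y - latticePlateau f) (volume.restrict (Ioo (0:ℝ) 1)) := by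
  refine ((ProfileBernoulli.stronglyMeasurable_psiInt f).aestronglyMeasurable).congr ?_
  filter_upwards [ae_restrict_mem measurableSet_Ioo] with y hy
  exact ProfileBernoulli.psiInt_eq hC h1 hI hy.1

/-- `ψ_f / y` is a.e.-strongly measurable on `(0,1)`. [folklore] -/
theorem aestronglyMeasurable_profile_sub_plateau_div {f : ℝ → ℝ} (hC : ContDiffOn ℝ 1 f (Icc 0 1))
    (h1 : f 1 = 0) (hI : ∫ u in (0:ℝ)..1, f u = 0) :
    AEStronglyMeasurable (fun y => (latticeProfile f y - latticePlateau f) / y)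
      (volume.restrict (Ioo (0:ℝ) 1)) :=
  (aestronglyMeasurable_profile_sub_plateau hC h1 hI).mul measurable_inv.aestronglyMeasurable

/-- For `C²` data, `ψ_f²/y²` is integrable on `(0,1)` (it is bounded, `|ψ_f(y)| ≤ C y`). [folklore] -/
theorem integrableOn_profile_sq_div_C2 {f : ℝ → ℝ} (hC2 : ContDiffOn ℝ 2 f (Icc 0 1)) (h1 : f 1 = 0)
    (hI : ∫ u in (0:ℝ)..1, f u = 0) :
    IntegrableOn (fun y => (latticeProfile f y - latticePlateau f) ^ 2 / y ^ 2) (Ioo (0:ℝ) 1) := by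
  have hC1 : ContDiffOn ℝ 1 f (Icc 0 1) := hC2.of_le (by norm_num)
  obtain ⟨C, hC0, hCy⟩ := ProfileBernoulli.exists_profile_sub_plateau_le_mul hC2 h1 hI
  have hmeas : AEStronglyMeasurable (fun y => (latticeProfile f y - latticePlateau f) ^ 2 / y ^ 2)
      (volume.restrict (Ioo (0:ℝ) 1)) :=
    ((aestronglyMeasurable_profile_sub_plateau hC1 h1 hI).pow 2).mul
      ((measurable_id.pow_const 2).inv.aestronglyMeasurable)
  refine IntegrableOn.of_bound measure_Ioo_lt_top hmeas (C ^ 2) ?_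
  filter_upwards [ae_restrict_mem measurableSet_Ioo] with y hy
  have hy0 : 0 < y := hy.1
  have hb := hCy y hy0
  rw [Real.norm_eq_abs, abs_of_nonneg (by positivity)]
  have hsq : (latticeProfile f y - latticePlateau f) ^ 2 ≤ (C * y) ^ 2 := by
    rw [← sq_abs]; exact pow_le_pow_left₀ (abs_nonneg _) hb 2
  calc (latticeProfile f y - latticePlateau f) ^ 2 / y ^ 2 ≤ (C * y) ^ 2 / y ^ 2 := by gcongr
    _ = C ^ 2 := by field_simp

/-- `MemLp 2` of `ψ_f/y` on `(0,1)` from integrability of `ψ_f²/y²`. [folklore] -/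
theorem memLp_two_profile_div {f : ℝ → ℝ} (hC : ContDiffOn ℝ 1 f (Icc 0 1)) (h1 : f 1 = 0)
    (hI : ∫ u in (0:ℝ)..1, f u = 0)
    (hint : IntegrableOn (fun y => (latticeProfile f y - latticePlateau f) ^ 2 / y ^ 2) (Ioo (0:ℝ) 1)) :
    MemLp (fun y => (latticeProfile f y - latticePlateau f) / y) 2 (volume.restrict (Ioo (0:ℝ) 1)) := by
  rw [memLp_two_iff_integrable_sq (aestronglyMeasurable_profile_sub_plateau_div hC h1 hI)]
  exact hint.congr (ae_of_all _ fun y => by simp only; ring)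

/-! ## the co-profile of a `C²` function on `ℝ`: `derivWithin = deriv` -/

/-- For `p` differentiable on `ℝ`, `derivWithin p [0,1] = deriv p` on `[0,1]`. [folklore] -/
theorem derivWithin_Icc_eq_deriv_of_differentiable {p : ℝ → ℝ} (hp : Differentiable ℝ p) {u : ℝ}
    (hu : u ∈ Icc (0:ℝ) 1) : derivWithin p (Icc 0 1) u = deriv p u :=
  (hp u).derivWithin (uniqueDiffOn_Icc zero_lt_one u hu)

/-! ## the density theorem -/

/-- **K1 for `C¹` data (density).**  For `g ∈ C¹[0,1]` with `g(1) = 0`, `∫₀¹ g = 0` and `(h − h₀)²/y²`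
integrable on `(0,1)`: `∫₀¹ (h − h₀)² y⁻² dy + h₀² = (4π²)⁻¹ ∫₀¹ Φ_g²`. [folklore] -/
theorem profile_isometry {g : ℝ → ℝ} (hC : ContDiffOn ℝ 1 g (Icc 0 1)) (h1 : g 1 = 0)
    (hI : ∫ u in (0:ℝ)..1, g u = 0)
    (hint : IntegrableOn (fun y => (latticeProfile g y - latticePlateau g) ^ 2 / y ^ 2) (Ioo (0:ℝ) 1)) :
    (∫ y in Ioo (0:ℝ) 1, (latticeProfile g y - latticePlateau g) ^ 2 / y ^ 2) + latticePlateau g ^ 2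
      = (1 / (4 * Real.pi ^ 2)) * ∫ t in Ioo (0:ℝ) 1, (latticeCoprofile g t) ^ 2 := by
  -- the approximants
  set δ : ℕ → ℝ := fun k => 1 / ((k:ℝ) + 1) with hδ_def
  have hδpos : ∀ k, 0 < δ k := fun k => by positivity
  have hδ0 : Tendsto δ atTop (𝓝 0) := tendsto_one_div_add_atTop_nhds_zero_nat
  choose p hp using fun k : ℕ => exists_smooth_approx hC h1 hI (hδpos k)
  -- unpack
  have hpC2 : ∀ k, ContDiff ℝ 2 (p k) := fun k => (hp k).1
  have hpC2' : ∀ k, ContDiffOn ℝ 2 (p k) (Icc 0 1) := fun k => (hpC2 k).contDiffOn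
  have hpC1 : ∀ k, ContDiff ℝ 1 (p k) := fun k => (hpC2 k).of_le (by norm_num)
  have hpC1' : ∀ k, ContDiffOn ℝ 1 (p k) (Icc 0 1) := fun k => (hpC1 k).contDiffOn
  have hpd : ∀ k, Differentiable ℝ (p k) := fun k => (hpC1 k).differentiable one_ne_zero
  have hp1 : ∀ k, p k 1 = 0 := fun k => (hp k).2.1
  have hpI : ∀ k, ∫ u in (0:ℝ)..1, p k u = 0 := fun k => (hp k).2.2.1
  have hpδ : ∀ k, ∀ u ∈ Icc (0:ℝ) 1, |deriv (p k) u - derivWithin g (Icc 0 1) u| ≤ δ k :=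
    fun k => (hp k).2.2.2.1
  have hp0 : ∀ k, |p k 0 - g 0| ≤ δ k := fun k => (hp k).2.2.2.2
  -- notation
  set c : ℝ := 1 / (4 * Real.pi ^ 2) with hc
  have hc0 : 0 ≤ c := by positivity
  set μ : Measure ℝ := volume.restrict (Ioo (0:ℝ) 1) with hμ
  ----------------------------------------------------------------
  -- (1) the `C²` isometry for each `p_k`
  have hiso : ∀ k, (∫ y in Ioo (0:ℝ) 1, ((latticeProfile (p k) y - latticePlateau (p k))) ^ 2 / y ^ 2) + latticePlateau (p k) ^ 2
      = c * ∫ t in Ioo (0:ℝ) 1, (latticeCoprofile (p k) t) ^ 2 := fun k =>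
    ProfileBernoulli.coprofileIsometry_C2 (hpC2' k) (hp1 k) (hpI k)
  ----------------------------------------------------------------
  -- (2) Cauchy estimate: ∫ (ψ_k − ψ_m)²/y² ≤ c·50(δ_k+δ_m)², and integrability
  have hdiffC2 : ∀ k m, ContDiffOn ℝ 2 (fun u => p k u - p m u) (Icc 0 1) := fun k m =>
    ((hpC2 k).sub (hpC2 m)).contDiffOn
  have hdiff1 : ∀ k m, (fun u => p k u - p m u) 1 = 0 := fun k m => by simp [hp1]
  have hdiffI : ∀ k m, ∫ u in (0:ℝ)..1, (fun u => p k u - p m u) u = 0 := fun k m => by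
    show ∫ u in (0:ℝ)..1, (p k u - p m u) = 0
    rw [intervalIntegral.integral_sub ((hpC1 k).continuous.intervalIntegrable _ _)
      ((hpC1 m).continuous.intervalIntegrable _ _), hpI, hpI, sub_zero]
  have hΦdiff : ∀ k m t, latticeCoprofile (fun u => p k u - p m u) t
      = latticeCoprofile (p k) t - latticeCoprofile (p m) t := fun k m t => by
    rw [latticeCoprofile_sub]
    unfold latticeCoprofile
    refine Finset.sum_congr rfl fun n _ => ?_
    have hd : deriv (fun u => p k u - p m u) ((n:ℝ) * t) = deriv (p k) ((n:ℝ) * t) - deriv (p m) ((n:ℝ) * t) :=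
      ((hpd k _).hasDerivAt.sub (hpd m _).hasDerivAt).deriv
    rw [hd]
  have hδkm : ∀ k m, ∀ u ∈ Icc (0:ℝ) 1,
      |deriv (p k) u - derivWithin (p m) (Icc 0 1) u| ≤ δ k + δ m := fun k m u hu => by
    rw [derivWithin_Icc_eq_deriv_of_differentiable (hpd m) hu]
    have h1' := hpδ k u hu
    have h2' := hpδ m u hu
    calc |deriv (p k) u - deriv (p m) u|
        = |(deriv (p k) u - derivWithin g (Icc 0 1) u) - (deriv (p m) u - derivWithin g (Icc 0 1) u)| := by
          ring_nf
      _ ≤ |deriv (p k) u - derivWithin g (Icc 0 1) u| + |deriv (p m) u - derivWithin g (Icc 0 1) u| :=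
          abs_sub _ _
      _ ≤ δ k + δ m := add_le_add h1' h2'
  have hcauchy : ∀ k m, ∫ y in Ioo (0:ℝ) 1, ((latticeProfile (p k) y - latticePlateau (p k)) - (latticeProfile (p m) y - latticePlateau (p m))) ^ 2 / y ^ 2
      ≤ c * (50 * (δ k + δ m) ^ 2) := fun k m => by
    have hisoD := ProfileBernoulli.coprofileIsometry_C2 (hdiffC2 k m) (hdiff1 k m) (hdiffI k m)
    simp only [profile_sub_plateau_sub] at hisoD
    have hΦ : ∫ t in Ioo (0:ℝ) 1, (latticeCoprofile (fun u => p k u - p m u) t) ^ 2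
        ≤ 50 * (δ k + δ m) ^ 2 := by
      simp only [hΦdiff]
      exact integral_coprofile_sub_sq_le (by linarith [hδpos k, hδpos m]) (hδkm k m)
    have e : (fun t => (∑ n ∈ Finset.Icc 1 ⌊1 / t⌋₊, deriv (fun u => p k u - p m u) (↑n * t) / ↑n) ^ 2)
        = fun t => (latticeCoprofile (fun u => p k u - p m u) t) ^ 2 := rfl
    rw [e] at hisoD
    nlinarith [sq_nonneg (latticePlateau fun u => p k u - p m u), hisoD, hΦ, hc0]
  have hintkm : ∀ k m, IntegrableOn (fun y => ((latticeProfile (p k) y - latticePlateau (p k)) - (latticeProfile (p m) y - latticePlateau (p m))) ^ 2 / y ^ 2) (Ioo (0:ℝ) 1) :=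
    fun k m => by
    have h := integrableOn_profile_sq_div_C2 (hdiffC2 k m) (hdiff1 k m) (hdiffI k m)
    refine h.congr_fun (fun y _ => ?_) measurableSet_Ioo
    simp only [profile_sub_plateau_sub]
  ----------------------------------------------------------------
  -- (3) uniform closeness ψ_m → ψ_g and the truncation lemma: D_k ≤ 2·c·50·δ_k²
  have hclose : ∀ m, ∀ y ∈ Ioo (0:ℝ) 1, |(latticeProfile (p m) y - latticePlateau (p m)) - (latticeProfile g y - latticePlateau g)| ≤ δ m / 2 := fun m y hy =>
    abs_profile_sub_profile_le (hpC1 m) (hp1 m) (hpI m) hC h1 hI (hpδ m) hy.1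
  have hintk : ∀ k, IntegrableOn (fun y => ((latticeProfile (p k) y - latticePlateau (p k))) ^ 2 / y ^ 2) (Ioo (0:ℝ) 1) := fun k =>
    integrableOn_profile_sq_div_C2 (hpC2' k) (hp1 k) (hpI k)
  have hintkg : ∀ k, IntegrableOn (fun y => ((latticeProfile (p k) y - latticePlateau (p k)) - (latticeProfile g y - latticePlateau g)) ^ 2 / y ^ 2) (Ioo (0:ℝ) 1) := fun k => by
    have hmaj : IntegrableOn (fun y => 2 * (((latticeProfile (p k) y - latticePlateau (p k))) ^ 2 / y ^ 2) + 2 * (((latticeProfile g y - latticePlateau g)) ^ 2 / y ^ 2))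
        (Ioo (0:ℝ) 1) := ((hintk k).const_mul 2).add (hint.const_mul 2)
    have hmeas : AEStronglyMeasurable (fun y => ((latticeProfile (p k) y - latticePlateau (p k)) - (latticeProfile g y - latticePlateau g)) ^ 2 / y ^ 2) μ :=
      (((aestronglyMeasurable_profile_sub_plateau (hpC1' k) (hp1 k) (hpI k)).sub
        (aestronglyMeasurable_profile_sub_plateau hC h1 hI)).pow 2).mul
        ((measurable_id.pow_const 2).inv.aestronglyMeasurable)
    refine hmaj.mono' hmeas ?_
    filter_upwards [ae_restrict_mem measurableSet_Ioo] with y hy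
    rw [Real.norm_eq_abs, abs_of_nonneg (by positivity)]
    have hpt : ((latticeProfile (p k) y - latticePlateau (p k)) - (latticeProfile g y - latticePlateau g)) ^ 2 ≤ 2 * ((latticeProfile (p k) y - latticePlateau (p k))) ^ 2 + 2 * ((latticeProfile g y - latticePlateau g)) ^ 2 := by
      nlinarith [sq_nonneg ((latticeProfile (p k) y - latticePlateau (p k)) + (latticeProfile g y - latticePlateau g))]
    calc ((latticeProfile (p k) y - latticePlateau (p k)) - (latticeProfile g y - latticePlateau g)) ^ 2 / y ^ 2 ≤ (2 * ((latticeProfile (p k) y - latticePlateau (p k))) ^ 2 + 2 * ((latticeProfile g y - latticePlateau g)) ^ 2) / y ^ 2 := by gcongr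
      _ = 2 * (((latticeProfile (p k) y - latticePlateau (p k))) ^ 2 / y ^ 2) + 2 * (((latticeProfile g y - latticePlateau g)) ^ 2 / y ^ 2) := by ring
  have hD : ∀ k, ∫ y in Ioo (0:ℝ) 1, ((latticeProfile (p k) y - latticePlateau (p k)) - (latticeProfile g y - latticePlateau g)) ^ 2 / y ^ 2 ≤ 2 * (c * (50 * (δ k + 0) ^ 2)) :=
    fun k => by
    refine setIntegral_sq_div_le_of_approx (a := fun m y => (latticeProfile (p m) y - latticePlateau (p m))) (b := fun y => (latticeProfile g y - latticePlateau g)) (c := fun y => (latticeProfile (p k) y - latticePlateau (p k)))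
      (η := fun m => δ m / 2) (K := fun m => c * (50 * (δ k + δ m) ^ 2)) ?_ hclose (hintkm k)
      (hcauchy k) ?_ (hintkg k)
    · simpa using hδ0.div_const 2
    · exact ((tendsto_const_nhds.add hδ0).pow 2 |>.const_mul 50).const_mul c
  ----------------------------------------------------------------
  -- (4) ∫ ψ_k²/y² → ∫ ψ_g²/y²
  have hDlim : Tendsto (fun k => ∫ y, ((latticeProfile (p k) y - latticePlateau (p k)) / y - (latticeProfile g y - latticePlateau g) / y) ^ 2 ∂μ) atTop (𝓝 0) := by
    have hup : Tendsto (fun k => 2 * (c * (50 * (δ k + 0) ^ 2))) atTop (𝓝 (2 * (c * (50 * (0 + 0) ^ 2)))) :=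
      ((hδ0.add tendsto_const_nhds).pow 2 |>.const_mul 50 |>.const_mul c).const_mul 2
    rw [add_zero, zero_pow two_ne_zero, mul_zero, mul_zero, mul_zero] at hup
    refine squeeze_zero (fun k => integral_nonneg fun y => sq_nonneg _) (fun k => ?_) hup
    have e : (fun y => ((latticeProfile (p k) y - latticePlateau (p k)) / y - (latticeProfile g y - latticePlateau g) / y) ^ 2) = fun y => ((latticeProfile (p k) y - latticePlateau (p k)) - (latticeProfile g y - latticePlateau g)) ^ 2 / y ^ 2 := by
      funext y; ring
    rw [e]; exact hD k
  have hψlim : Tendsto (fun k => ∫ y in Ioo (0:ℝ) 1, ((latticeProfile (p k) y - latticePlateau (p k))) ^ 2 / y ^ 2) atTop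
      (𝓝 (∫ y in Ioo (0:ℝ) 1, ((latticeProfile g y - latticePlateau g)) ^ 2 / y ^ 2)) := by
    have h := tendsto_integral_sq_of_tendsto_integral_sub_sq (μ := μ)
      (u := fun k y => (latticeProfile (p k) y - latticePlateau (p k)) / y) (v := fun y => (latticeProfile g y - latticePlateau g) / y)
      (fun k => memLp_two_profile_div (hpC1' k) (hp1 k) (hpI k) (hintk k))
      (memLp_two_profile_div hC h1 hI hint) hDlim
    have e1 : ∀ f : ℝ → ℝ, (∫ y, ((latticeProfile f y - latticePlateau f) / y) ^ 2 ∂μ) = ∫ y in Ioo (0:ℝ) 1, ((latticeProfile f y - latticePlateau f)) ^ 2 / y ^ 2 := fun f =>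
      integral_congr_ae (ae_of_all _ fun y => by simp only; ring)
    simpa only [e1] using h
  ----------------------------------------------------------------
  -- (5) ∫ Φ_k² → ∫ Φ_g²
  have hΦlim : Tendsto (fun k => ∫ t in Ioo (0:ℝ) 1, (latticeCoprofile (p k) t) ^ 2) atTop
      (𝓝 (∫ t in Ioo (0:ℝ) 1, (latticeCoprofile g t) ^ 2)) := by
    refine tendsto_integral_sq_of_tendsto_integral_sub_sq (μ := μ)
      (u := fun k t => latticeCoprofile (p k) t) (v := fun t => latticeCoprofile g t)
      (fun k => memLp_two_latticeCoprofile (hpC1' k)) (memLp_two_latticeCoprofile hC) ?_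
    have hup : Tendsto (fun k => 50 * (δ k) ^ 2) atTop (𝓝 (50 * 0 ^ 2)) := (hδ0.pow 2).const_mul 50
    rw [zero_pow two_ne_zero, mul_zero] at hup
    exact squeeze_zero (fun k => integral_nonneg fun y => sq_nonneg _)
      (fun k => integral_coprofile_sub_sq_le (hδpos k).le (hpδ k)) hup
  ----------------------------------------------------------------
  -- (6) h₀(p_k) → h₀(g)
  have hplat : Tendsto (fun k => latticePlateau (p k)) atTop (𝓝 (latticePlateau g)) := by
    rw [tendsto_iff_norm_sub_tendsto_zero]
    have hup : Tendsto (fun k => δ k / 2) atTop (𝓝 (0 / 2)) := hδ0.div_const 2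
    rw [zero_div] at hup
    refine squeeze_zero (fun k => norm_nonneg _) (fun k => ?_) hup
    rw [Real.norm_eq_abs, abs_plateau_sub_plateau]
    linarith [hp0 k]
  ----------------------------------------------------------------
  -- (7) pass to the limit in the identity
  have hL : Tendsto (fun k => (∫ y in Ioo (0:ℝ) 1, ((latticeProfile (p k) y - latticePlateau (p k))) ^ 2 / y ^ 2) + latticePlateau (p k) ^ 2)
      atTop (𝓝 ((∫ y in Ioo (0:ℝ) 1, ((latticeProfile g y - latticePlateau g)) ^ 2 / y ^ 2) + latticePlateau g ^ 2)) :=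
    hψlim.add (hplat.pow 2)
  have hR : Tendsto (fun k => c * ∫ t in Ioo (0:ℝ) 1, (latticeCoprofile (p k) t) ^ 2) atTop
      (𝓝 (c * ∫ t in Ioo (0:ℝ) 1, (latticeCoprofile g t) ^ 2)) := hΦlim.const_mul c
  have hEq : (fun k => (∫ y in Ioo (0:ℝ) 1, ((latticeProfile (p k) y - latticePlateau (p k))) ^ 2 / y ^ 2) + latticePlateau (p k) ^ 2)
      = fun k => c * ∫ t in Ioo (0:ℝ) 1, (latticeCoprofile (p k) t) ^ 2 := funext hiso
  rw [hEq] at hL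
  exact tendsto_nhds_unique hL hR

end Summit.RiemannHypothesis.RiemannHypothesis.Theorems.ScrewLemmaKCoprofile

end
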